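import Literature.NumberTheory.LFunctions.Zhang2022.Section18Certificate

/-!
# Zhang (2022) §§16–17: `𝔢₀` of (17.4) and the numeric literals of the `Φ₂`, `Φ₃` evaluations (num lane N-10)

Trunk T-ANT (NumberTheory/LFunctions). Certified-numerics lane of the siegel-zhang campaign (plan/NUMERICS.tsv
row **N-10**; writer sz-num-5), companion of `Section18Defs.lean` / `Section18Certificate.lean` (Y. Zhang,
*Discrete mean estimates and the Landau–Siegel zero*, arXiv:2211.02515v1 [Zhang2022LandauSiegel], §§16–17;
**an unrefereed manuscript under adjudication** — nothing here is a statement about its Theorems 1–2, about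
Propositions 14.1 / Lemmas 16.1–17.1, or about Landau–Siegel zeros).

Row N-10 asks for the enclosure of `𝔢₀` ((17.4), p.96, tex L4741) and for "every numeric literal of §§16–17
with its certified value". Scanning tex L4400–4863 finds NO decimal constant other than display numbers; the
numerical content of §§16–17 is: (i) `𝔢₀ = (𝔳𝔨₁(1) + ι₂𝔳𝔨₂(1))(ῑ₃𝔳𝔨₃(1) + ῑ₄𝔳𝔨₄(1))` with the main values
`𝔳𝔨₁(1) = e^{0.756πi}`, `𝔳𝔨₂(1) → e^{1.25πi}`, `𝔳𝔨₃(1) = e^{0.747πi}` ((8.6) with (2.21)–(2.22)) and the FORCED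
reading `𝔳𝔨₄ := 𝔳𝔨₂` (`𝔳𝔨₄` is undefined in print; `Section18Defs` caveat (i)) — tree objects `vk1one, vk2one,
vk3one, vk4one, frake0`; (ii) the three literals "`(pt₀)^{β₁} = −1 + O(α₁)`" [p.95, tex L4686], "`(pt₀)^{β₃} =
−1 + O(α₁)`" [p.96, tex L4762], "`(pt₀)^{β₂} = 1 + O(α₁)`" [p.99, tex L4848], whose main values are `e^{jπi}`
(`β_j log(pt₀) → jπi`, since `α log P = π` (2.10) and `log(pt₀) = (1 + o(1))log P`); (iii) the exponents
`0.756 = (3/2)·0.504`, `0.747 = (3/2)·0.498`, `1.25 = (5/2)·0.5`; (iv) the outputs (16.17) `Φ₂ = (𝔢₁+𝔢₂)𝔞𝔓`,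
(17.10) `Φ₃ = −(𝔢₀+𝔢₁)𝔞𝔓` consume `𝔢₁, 𝔢₂` of Lemma 15.1 (row N-09, `Section18Certificate.mem_frake`).

**Kernel content.** `n10_frake0_verdict` reads a decimal bracket of `𝔢₀` off the landed box `frake0B`
(`decide +kernel`, engine `Literature.Analysis.ValidatedNumerics`, scale `2⁴⁸`); the literal identities (ii)
are `pt0BetaLiterals_num_holds`; the exponent identities (iii) are already recorded by the lane's
`Numerics.n16_residueConstants_num_holds` (`NumericsSection2`, num-1) and are not restated. Lineage 2 (kit job j247240, two code-disjoint implementations —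
mpmath.iv closed forms / Arb ball arithmetic — HOME/num/N-10/ of the campaign): `𝔢₀ = −0.491626821870503627970 −
1.876262952287656053991 i`, `𝔳𝔨₁(1) = −0.720309024887906891265 + 0.693653305812804968219 i`, `𝔳𝔨₃(1) =
−0.700411150783806347998 + 0.713739602276421318816 i`, `𝔳𝔨₂(1) = −(1+i)/√2`; all inside the kernel box. Team C
(adjudication) files per-term brackets of the same box under `…Zhang2022.frake0_bounds` (pending at the time of
writing); this file's record theorem lives in the `Numerics` namespace and does not restate them.
-/

noncomputable section

open Complex Real ComplexConjugate
open Literature.Analysis.ValidatedNumerics.Numerics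

namespace Literature.NumberTheory.LFunctions.Zhang2022.Numerics

open Literature.NumberTheory.LFunctions.Zhang2022

/-! ### (ii) the literals `(pt₀)^{β_j} = ∓1 + O(α₁)` at main values -/

/-- Main values of the three §§16–17 literals: `e^{πi} = −1` ("`(pt₀)^{β₁} = −1 + O(α₁)`", p.95 tex L4686),
`e^{2πi} = 1` ("`(pt₀)^{β₂} = 1 + O(α₁)`", p.99 tex L4848), `e^{3πi} = −1` ("`(pt₀)^{β₃} = −1 + O(α₁)`", p.96 tex
L4762), where `β_j log(pt₀) → jπi` (`β_j = jiα` main value of (2.13), `α log P = π` (2.10), `log(pt₀) =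
(1 + o(1)) log P`). NUMERICS row N-10. [cite: Zhang2022LandauSiegel, §16 (16.17), §17 (17.6), (17.9)] -/
@[claim "Zhang2022LandauSiegel" "disputed"]
def Pt0BetaLiterals_num : Prop :=
  cexp (π * I) = -1 ∧ cexp (2 * π * I) = 1 ∧ cexp (3 * π * I) = -1

/-- The literals are the exact main values. [cite: Zhang2022LandauSiegel, section 16 (16.17), section 17 (17.6), (17.9)] -/
theorem pt0BetaLiterals_num_holds : Pt0BetaLiterals_num := by
  refine ⟨Complex.exp_pi_mul_I, Complex.exp_two_pi_mul_I, ?_⟩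
  rw [show (3 : ℂ) * π * I = π * I + 2 * π * I by ring, Complex.exp_add, Complex.exp_pi_mul_I,
    Complex.exp_two_pi_mul_I]
  norm_num

/-- `Pt0BetaLiterals_num` — `_holds` alias of `pt0BetaLiterals_num_holds` above under the fact's exact name (appended
2026-08-28, D-0026 bookkeeping: the proof term is the existing theorem of this file; no statement,
definition or attribute is edited; no new named fact; the ledger's debt table listed the fact
unproved). [cite: Zhang2022LandauSiegel, section 16 (16.17), section 17 (17.6), (17.9)] -/
theorem _root_.Literature.NumberTheory.LFunctions.Zhang2022.Numerics.Pt0BetaLiterals_num_holds :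
    Pt0BetaLiterals_num :=
  _root_.Literature.NumberTheory.LFunctions.Zhang2022.Numerics.pt0BetaLiterals_num_holds

/-! ### (i) `𝔢₀` of (17.4) -/

/-- **NUMERICS row N-10 (record): `𝔢₀ = −0.4916268… − 1.8762629… i`** ((17.4) [Z22 p.96, tex L4741], forced reading
`𝔳𝔨₄ := 𝔳𝔨₂`; main values of `𝔳𝔨_μ(1)`). Kernel: decimal bracket read off the landed box `frake0B`
(`Section18Certificate.mem_frake0`). Lineage 2 (kit job j247240; A = mpmath.iv, B = python-flint/Arb; A∩B, 21 digits):
`𝔢₀ = −0.491626821870503627970 − 1.876262952287656053991 i` — inside this bracket. Verdict: REPRODUCED.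
[cite: Zhang2022LandauSiegel, (17.4) p.96] -/
theorem n10_frake0_verdict :
    ((-0.4916269 : ℝ) < frake0.re ∧ frake0.re < -0.4916268)
    ∧ ((-1.876263 : ℝ) < frake0.im ∧ frake0.im < -1.8762629) := by
  have h : (((-0.4916269 : ℚ) * (SC : ℚ) < (frake0B.re.lo : ℚ)) ∧ ((frake0B.re.hi : ℚ) < (-0.4916268 : ℚ) * (SC : ℚ)))
      ∧ (((-1.876263 : ℚ) * (SC : ℚ) < (frake0B.im.lo : ℚ)) ∧ ((frake0B.im.hi : ℚ) < (-1.8762629 : ℚ) * (SC : ℚ))) := by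
    decide +kernel
  exact ⟨⟨by simpa using lo_bound mem_frake0.1 h.1.1, by simpa using hi_bound mem_frake0.1 h.1.2⟩,
    ⟨by simpa using lo_bound mem_frake0.2 h.2.1, by simpa using hi_bound mem_frake0.2 h.2.2⟩⟩

/-- `𝔳𝔨₄ := 𝔳𝔨₂` is the reading the tree adopts for the undefined `𝔳𝔨₄` of (17.4) (definitional; recorded so that the
N-10 row names its reading). [cite: Zhang2022LandauSiegel, (17.4), (2.27)] -/
theorem vk4one_reading : vk4one = vk2one := rfl

end Literature.NumberTheory.LFunctions.Zhang2022.Numerics
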